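import Summits.BirchSwinnertonDyer.BirchSwinnertonDyer.Theses.ShaPrimaryTransfer
import Literature.NumberTheory.EllipticCurves.KubertTate4849EisensteinTwist
import Literature.NumberTheory.EllipticCurves.CastellaGrossiLeeSkinner2022.PConverse
import Literature.NumberTheory.EllipticCurves.IwasawaLeadingTermProofs
import HarnessLib

/-!
# BirchSwinnertonDyer / ShaPrimaryTransfer — crux `FiniteShaComponentTransfer` (stmt-BirchSwinnertonDyer-22356):
# a RANK-1 Eisenstein-twist door `W₄ = [1, 7049, −12, −546819, −89653119743] ≅ E_{48/49}^{(-3)}` of a RANK-2 base curve, through the CLASS-WIDE reading (`r = 1`)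

Helper file of prover seat `bsd-line-spt-p1` g22 (`--supports stmt-22356 --as helper`). THEOREMS ONLY; route-independent imports (no Theorems
module of the route cone is imported).  Instantiation of the class-wide Literature theorem `KubertTateEisensteinTwist.cgls_hypotheses_of_model`
(the same content as `ShaPrimaryTransferEisensteinTwistDoor.transfer_of_eisensteinTwistModel_of_thmE`) at `(m, n) = (48, 49)`: `E_{48/49} = [1, -2352, -115248, 0, 0]`
(RANK `2`, full box, Eisenstein-tame, `mn = 2352`, `ω₂ = 1`), twist minimal model `W₄` (tree `KubertTate4849EisensteinTwist`: rank `1` by the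
point `P = (126701/25, 58155211/125)`, `t₅ = 0`, `a₅ = 4 ≡ -1`, `corank_{ℤ₅} Sel_{5^∞} = 1`, all through the class-wide `cgls_hypotheses_of_model`).
The base curve has rank `2` and the twist rank `1`: `rank E_{48/49}(ℚ(ζ₃)) = 3`.

* `oneFiniteShaComponent_W₄` (unconditional, door `5`), `transfer_W₄` (T by name);
* `analyticRank_W₄_eq_one_and_finite_sha_of_thmE`, **`transfer_W₄_of_thmE`** — modulo CGLS Thm. E + GZK: `ord_{s=1} L(W₄, s) = 1`, `Ш(W₄/ℚ)`
  finite, and T HOLDS AT `W₄`.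

T itself is UNCHANGED (open at corank ≥ 2) and BSD is NOT proved by any of this.

## References

* [CastellaGrossiLeeSkinner2022] F. Castella, G. Grossi, J. Lee, C. Skinner, Invent. Math. 227 (2022), Theorem E.
* [Darmon2004] H. Darmon, CBMS 101, Thm. 3.22 (Gross–Zagier–Kolyvagin).
* [SilvermanAEC2009] J. H. Silverman, *AEC*, 2nd ed., Thm. X.4.2, Exercise 10.16.
-/

-- D-0017: single-problem summit, so `Summit.BirchSwinnertonDyer.BirchSwinnertonDyer.…` repeats a namespace BY DESIGN.
set_option linter.dupNamespace false
set_option autoImplicit false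

noncomputable section

open scoped Classical
open Literature.NumberTheory.EllipticCurves WeierstrassCurve
open Literature.NumberTheory.EllipticCurves.Rank1Residual
open Literature.NumberTheory.EllipticCurves.CastellaGrossiLeeSkinner2022
open Summit.BirchSwinnertonDyer.BirchSwinnertonDyer.Theses.ShaPrimaryTransfer

namespace Summit.BirchSwinnertonDyer.BirchSwinnertonDyer.Theorems.ShaPrimaryTransferEisensteinTwistDoor4849

/-- **O for `W₄` with witness `p₀ = 5`, unconditional** (`t₅(W₄) = corank Sel₅∞ − rank = 1 − 1`; tree `cgls_hypotheses_48_49`).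
[cite: SilvermanAEC2009, Thm. X.4.2] -/
theorem oneFiniteShaComponent_W₄ :
    haveI := KubertTate4849EisensteinTwist.isElliptic_model
    ∃ (p : ℕ) (_ : Fact p.Prime),
      (⟨((1 : ℤ) : ℚ), ((7049 : ℤ) : ℚ), ((-12 : ℤ) : ℚ), ((-546819 : ℤ) : ℚ), ((-89653119743 : ℤ) : ℚ)⟩ : WeierstrassCurve ℚ).shaCorank p = 0 := by
  haveI := KubertTate4849EisensteinTwist.isElliptic_model
  haveI := KubertTate4849EisensteinTwist.isGloballyMinimal_model
  haveI : Fact (Nat.Prime 5) := ⟨Nat.prime_five⟩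
  refine ⟨5, inferInstance, ?_⟩
  obtain ⟨-, -, -, hsel, hrk⟩ := KubertTate4849EisensteinTwist.cgls_hypotheses_48_49
  have hG := (⟨((1 : ℤ) : ℚ), ((7049 : ℤ) : ℚ), ((-12 : ℤ) : ℚ), ((-546819 : ℤ) : ℚ), ((-89653119743 : ℤ) : ℚ)⟩ :
    WeierstrassCurve ℚ).selmerCorank_eq_mordellWeilRank_add_holds 5
  omega

/-- **T BY NAME on `W₄`**: granting `FiniteShaComponentTransfer`, every `t_q(W₄) = 0`. T itself is NOT proved. [cite: SilvermanAEC2009, Thm. X.4.2] -/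
theorem transfer_W₄ (hT : FiniteShaComponentTransfer) (q : ℕ) [Fact q.Prime] :
    haveI := KubertTate4849EisensteinTwist.isElliptic_model
    (⟨((1 : ℤ) : ℚ), ((7049 : ℤ) : ℚ), ((-12 : ℤ) : ℚ), ((-546819 : ℤ) : ℚ), ((-89653119743 : ℤ) : ℚ)⟩ : WeierstrassCurve ℚ).shaCorank q = 0 := by
  haveI := KubertTate4849EisensteinTwist.isElliptic_model
  obtain ⟨p, hp, h0⟩ := oneFiniteShaComponent_W₄
  exact hT _ p q h0

/-- **`ord_{s=1} L(W₄, s) = 1 = rank W₄(ℚ)` and `Ш(W₄/ℚ)` finite, modulo CGLS Thm. E (`r = 1`) + GZK**: the pair `(W₄, 5)` is a non-anomalous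
Eisenstein pair of good reduction with `corank_{ℤ₅} Sel_{5^∞}(W₄/ℚ) = 1` (tree `cgls_hypotheses_48_49`, via the class-wide theorem).
[cite: CastellaGrossiLeeSkinner2022, Theorem E (r = 1)] [cite: Darmon2004, Thm. 3.22] -/
theorem analyticRank_W₄_eq_one_and_finite_sha_of_thmE
    (h1 : thmE_analyticRank_eq_one_of_selmerCorank_eq_one) (hGZK : rank_eq_analyticRank_of_analyticRank_le_one) :
    haveI := KubertTate4849EisensteinTwist.isElliptic_model
    (⟨((1 : ℤ) : ℚ), ((7049 : ℤ) : ℚ), ((-12 : ℤ) : ℚ), ((-546819 : ℤ) : ℚ), ((-89653119743 : ℤ) : ℚ)⟩ : WeierstrassCurve ℚ).analyticRank = 1 ∧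
      (⟨((1 : ℤ) : ℚ), ((7049 : ℤ) : ℚ), ((-12 : ℤ) : ℚ), ((-546819 : ℤ) : ℚ), ((-89653119743 : ℤ) : ℚ)⟩ : WeierstrassCurve ℚ).mordellWeilRank = 1 ∧
      Finite (⟨((1 : ℤ) : ℚ), ((7049 : ℤ) : ℚ), ((-12 : ℤ) : ℚ), ((-546819 : ℤ) : ℚ), ((-89653119743 : ℤ) : ℚ)⟩ : WeierstrassCurve ℚ).sha := by
  haveI := KubertTate4849EisensteinTwist.isElliptic_model
  haveI := KubertTate4849EisensteinTwist.isGloballyMinimal_model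
  haveI : Fact (Nat.Prime 5) := ⟨Nat.prime_five⟩
  obtain ⟨hgood, hred, hna, hsel, hrk⟩ := KubertTate4849EisensteinTwist.cgls_hypotheses_48_49
  obtain ⟨ha, -, hfin⟩ := rank_eq_one_and_finite_sha_of_thmE (p := 5) h1 hGZK (by norm_num) hgood hred hna hsel
  exact ⟨ha, hrk, hfin⟩

/-- **T DISCHARGED AT `W₄` MODULO REFEREED PRINT** (CGLS Thm. E + GZK): every `t_q(W₄) = 0`. [cite: CastellaGrossiLeeSkinner2022, Theorem E]
[cite: Darmon2004, Thm. 3.22] -/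
theorem transfer_W₄_of_thmE (h1 : thmE_analyticRank_eq_one_of_selmerCorank_eq_one)
    (hGZK : rank_eq_analyticRank_of_analyticRank_le_one) (p q : ℕ) [Fact p.Prime] [Fact q.Prime] :
    haveI := KubertTate4849EisensteinTwist.isElliptic_model
    (⟨((1 : ℤ) : ℚ), ((7049 : ℤ) : ℚ), ((-12 : ℤ) : ℚ), ((-546819 : ℤ) : ℚ), ((-89653119743 : ℤ) : ℚ)⟩ : WeierstrassCurve ℚ).shaCorank p = 0 →
      (⟨((1 : ℤ) : ℚ), ((7049 : ℤ) : ℚ), ((-12 : ℤ) : ℚ), ((-546819 : ℤ) : ℚ), ((-89653119743 : ℤ) : ℚ)⟩ : WeierstrassCurve ℚ).shaCorank q = 0 := by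
  haveI := KubertTate4849EisensteinTwist.isElliptic_model
  intro _
  haveI := (analyticRank_W₄_eq_one_and_finite_sha_of_thmE h1 hGZK).2.2
  exact (finite_primaryComponent_sha_iff_shaCorank_eq_zero _ q).1 inferInstance

end Summit.BirchSwinnertonDyer.BirchSwinnertonDyer.Theorems.ShaPrimaryTransferEisensteinTwistDoor4849

end
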